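import Literature.Geometry.Lorentzian.BogovskiiFrozenOperator
import Literature.Analysis.Calculus.DiagonalRestrictionL2
import HarnessLib

/-!
# The variable-coefficient CZ term of `∂_k∂_l S_η`: `L²` bound of the diagonal restriction of the frozen operator

(trunk G08 = T-LORENTZ; family `gr`; namespace `Literature.Geometry.Lorentzian.MaoOhTao`.)

Mao–Oh–Tao (arXiv:2308.13031), Lemma 2.3 (S3).  The principal term of `∂_k∂_l S_η f` is the singular integral
`x ↦ ∫ (1 − θ_ε)(x − y) K₂[η](x − y; x) f(y) dy = T_ε[η](x, x)` with the *base point frozen at the output point*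
(`BogovskiiFrozenOperator`).  By the diagonal-restriction device `Literature.Analysis.Calculus.exists_diag_lintegral_sq_le`
(three mixed `w`-derivatives, which fall on `η`: `∂_w^β T_ε[η] = T_ε[∂^βη]`) and the uniform `L²` bounds of the frozen
convolution operators (`exists_frozenOp_l2Const`), for `η ∈ C⁷` vanishing off `B̄_R` and a bounded measurable weight
`ζ` supported in `B̄_{D}`:

  `∫ |ζ(x) T_ε[η](x, x)|² dx ≤ C ∫ |g|²`  uniformly in `ε > 0` (`exists_diagFrozenOp_l2Const`).

## References

* Y. Mao, S.-J. Oh, T. Tao, arXiv:2308.13031 (2023), Lemma 2.3, pp. 8–9 (key `MaoOhTao2023`).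
-/

noncomputable section

open scoped RealInnerProductSpace Topology ENNReal
open Filter MeasureTheory Set Metric Function
open Literature.Analysis.FluidPDE

namespace Literature.Geometry.Lorentzian

namespace MaoOhTao

variable {η : E3 → ℝ} {R : ℝ}

/-- Iterated partials of `η ∈ C⁷` vanishing off `B̄_R` are `C⁴` and vanish off `B̄_R`. [folklore] -/
theorem contDiff_four_pd_iter (hη : ContDiff ℝ 7 η) (hR : ∀ z : E3, R < ‖z‖ → η z = 0) (a b c : Fin 3) :
    (ContDiff ℝ 4 η ∧ ∀ z : E3, R < ‖z‖ → η z = 0) ∧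
    (ContDiff ℝ 4 (pd a η) ∧ ∀ z : E3, R < ‖z‖ → pd a η z = 0) ∧
    (ContDiff ℝ 4 (pd b (pd a η)) ∧ ∀ z : E3, R < ‖z‖ → pd b (pd a η) z = 0) ∧
    (ContDiff ℝ 4 (pd c (pd b (pd a η))) ∧ ∀ z : E3, R < ‖z‖ → pd c (pd b (pd a η)) z = 0) := by
  obtain ⟨ha, hRa⟩ := contDiff_pd_and_vanish (n := 6) hη hR a
  obtain ⟨hb, hRb⟩ := contDiff_pd_and_vanish (n := 5) ha hRa b
  obtain ⟨hc, hRc⟩ := contDiff_pd_and_vanish (n := 4) hb hRb c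
  exact ⟨⟨hη.of_le (by norm_cast), hR⟩, ⟨ha.of_le (by norm_cast), hRa⟩, ⟨hb.of_le (by norm_cast), hRb⟩, ⟨hc, hRc⟩⟩

/-- **`L²` bound of the diagonal restriction of the frozen truncated operator** (the variable-coefficient
Calderón–Zygmund term of `∂_k∂_l S_η`): for `η ∈ C⁷` vanishing off `B̄_R` and a measurable weight `|ζ| ≤ 1` vanishing
for `|x| > D`, there is `C < ∞` with `∫ |ζ(x) T_ε[η](x, x)|² dx ≤ C ∫|g|²` for all `ε > 0` and all continuous compactly
supported `g`. [cite: MaoOhTao2023, Lemma 2.3 (S3)] -/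
theorem exists_diagFrozenOp_l2Const (hη : ContDiff ℝ 7 η) (hR : ∀ z : E3, R < ‖z‖ → η z = 0) (i j k l : Fin 3)
    {ζ : E3 → ℝ} (hζm : Measurable ζ) (hζ1 : ∀ x, |ζ x| ≤ 1) {D : ℝ} (hζD : ∀ x : E3, D < ‖x‖ → ζ x = 0) :
    ∃ C : ℝ≥0∞, C < ⊤ ∧ ∀ ε : ℝ, 0 < ε → ∀ g : E3 → ℝ, Continuous g → HasCompactSupport g →
      ∫⁻ x, ‖ζ x * ∫ t, (1 - radialCutoff ε (2 * ε) t) * bogovskiiK2 η x i j k l t * g (x - t)‖ₑ ^ (2 : ℝ) ≤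
        C * ∫⁻ x, ‖g x‖ₑ ^ (2 : ℝ) := by
  obtain ⟨Cd, hCd, hdiag⟩ := Literature.Analysis.Calculus.exists_diag_lintegral_sq_le
  -- the eight kernels `η`, `∂_0η`, `∂_1η`, `∂_2η`, `∂_1∂_0η`, `∂_2∂_0η`, `∂_2∂_1η`, `∂_2∂_1∂_0η`
  obtain ⟨⟨h4, -⟩, ⟨h0, hR0⟩, ⟨h10, hR10⟩, ⟨h210, hR210⟩⟩ := contDiff_four_pd_iter hη hR 0 1 2
  obtain ⟨-, ⟨h1, hR1⟩, ⟨h21, hR21⟩, -⟩ := contDiff_four_pd_iter hη hR 1 2 0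
  obtain ⟨-, ⟨h2, hR2⟩, -, -⟩ := contDiff_four_pd_iter hη hR 2 0 0
  obtain ⟨-, -, ⟨h20, hR20⟩, -⟩ := contDiff_four_pd_iter hη hR 0 2 0
  -- uniform `L²` constants on `|w| ≤ D + 1`
  obtain ⟨C₀, hC₀, hL₀⟩ := exists_frozenOp_l2Const h4 hR i j k l (D + 1)
  obtain ⟨Ct, hCt, hLt⟩ := exists_frozenOp_l2Const h0 hR0 i j k l (D + 1)
  obtain ⟨Cv, hCv, hLv⟩ := exists_frozenOp_l2Const h1 hR1 i j k l (D + 1)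
  obtain ⟨Cu, hCu, hLu⟩ := exists_frozenOp_l2Const h2 hR2 i j k l (D + 1)
  obtain ⟨Cvt, hCvt, hLvt⟩ := exists_frozenOp_l2Const h10 hR10 i j k l (D + 1)
  obtain ⟨Cut, hCut, hLut⟩ := exists_frozenOp_l2Const h20 hR20 i j k l (D + 1)
  obtain ⟨Cuv, hCuv, hLuv⟩ := exists_frozenOp_l2Const h21 hR21 i j k l (D + 1)
  obtain ⟨Cuvt, hCuvt, hLuvt⟩ := exists_frozenOp_l2Const h210 hR210 i j k l (D + 1)
  set Vol : ℝ≥0∞ := volume (closedBall (0 : E3) (D + 1)) with hVol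
  have hVoltop : Vol < ⊤ := measure_closedBall_lt_top
  set Cs : ℝ≥0∞ := C₀ + Ct + Cv + Cu + Cvt + Cut + Cuv + Cuvt with hCs
  have hCstop : Cs < ⊤ := by
    simp only [hCs, ENNReal.add_lt_top]
    exact ⟨⟨⟨⟨⟨⟨⟨hC₀, hCt⟩, hCv⟩, hCu⟩, hCvt⟩, hCut⟩, hCuv⟩, hCuvt⟩
  refine ⟨Cd * (8 * (Vol * Cs)), ENNReal.mul_lt_top hCd (ENNReal.mul_lt_top (by norm_num)
    (ENNReal.mul_lt_top hVoltop hCstop)), ?_⟩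
  intro ε hε g hg hgc
  -- the frozen operators with the eight kernels, weighted by `ζ`
  set T : (E3 → ℝ) → E3 → E3 → ℝ := fun ψ w x ↦
    ζ x * ∫ t, (1 - radialCutoff ε (2 * ε) t) * bogovskiiK2 ψ w i j k l t * g (x - t) with hT
  have hC3 : ∀ x, ContDiff ℝ 3 fun w ↦ T η w x := fun x ↦
    contDiff_const.mul (contDiff_frozenOp hε hg hgc i j k l 3 η hη hR x)
  -- base-point derivatives fall on `η`
  have hder : ∀ (ψ : E3 → ℝ), ContDiff ℝ 4 ψ → (∀ z : E3, R < ‖z‖ → ψ z = 0) → ∀ (a : Fin 3) (w x : E3),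
      fderiv ℝ (fun w ↦ T ψ w x) w (EuclideanSpace.single a 1) = T (pd a ψ) w x := by
    intro ψ hψ hRψ a w x
    simp only [hT]
    rw [fderiv_const_mul ((differentiable_frozenOp hψ hRψ hε hg hgc i j k l x) w)]
    simp only [FunLike.coe_smul, Pi.smul_apply, smul_eq_mul]
    rw [show (EuclideanSpace.single a (1 : ℝ) : E3) = e a from rfl, fderiv_frozenOp_e hψ hRψ hε hg hgc i j k l x w a]
  -- measurability
  have hmeas : ∀ (ψ : E3 → ℝ), ContDiff ℝ 4 ψ → Measurable (uncurry (T ψ)) := by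
    intro ψ hψ
    have h := measurable_frozenOp_uncurry (hψ.of_le (by norm_cast)) ε hg i j k l (g := g)
    exact (hζm.comp measurable_snd).mul h
  -- support in `x`
  have hsupp : ∀ (ψ : E3 → ℝ) (w x : E3), D < ‖x‖ → T ψ w x = 0 := by
    intro ψ w x hx
    simp only [hT, hζD x hx, zero_mul]
  have hmain := hdiag D (T η) (T (pd 0 η)) (T (pd 1 η)) (T (pd 2 η)) (T (pd 1 (pd 0 η))) (T (pd 2 (pd 0 η)))
    (T (pd 2 (pd 1 η))) (T (pd 2 (pd 1 (pd 0 η)))) hC3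
    (hder η h4 hR 0) (hder η h4 hR 1) (hder η h4 hR 2) (hder _ h0 hR0 1) (hder _ h0 hR0 2) (hder _ h1 hR1 2)
    (hder _ h10 hR10 2) (hmeas η h4) (hmeas _ h0) (hmeas _ h1) (hmeas _ h2) (hmeas _ h10) (hmeas _ h20)
    (hmeas _ h21) (hmeas _ h210)
    (fun w x hx ↦ ⟨hsupp _ w x hx, hsupp _ w x hx, hsupp _ w x hx, hsupp _ w x hx, hsupp _ w x hx, hsupp _ w x hx,
      hsupp _ w x hx, hsupp _ w x hx⟩)
  -- each of the eight terms is `≤ Vol * Cs * ‖g‖₂²`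
  set G : ℝ≥0∞ := ∫⁻ x, ‖g x‖ₑ ^ (2 : ℝ) with hG
  have hterm : ∀ (ψ : E3 → ℝ) (Cψ : ℝ≥0∞), Cψ ≤ Cs →
      (∀ ε : ℝ, 0 < ε → ∀ w : E3, ‖w‖ ≤ D + 1 → ∀ g : E3 → ℝ, Continuous g → HasCompactSupport g →
        ∫⁻ x, ‖∫ t, (1 - radialCutoff ε (2 * ε) t) * bogovskiiK2 ψ w i j k l t * g (x - t)‖ₑ ^ (2 : ℝ) ≤
          Cψ * ∫⁻ x, ‖g x‖ₑ ^ (2 : ℝ)) →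
      ∫⁻ w in closedBall (0 : E3) (D + 1), ∫⁻ x, ‖T ψ w x‖ₑ ^ (2 : ℝ) ≤ Vol * Cs * G := by
    intro ψ Cψ hCψ hL
    have hin : ∀ w ∈ closedBall (0 : E3) (D + 1), ∫⁻ x, ‖T ψ w x‖ₑ ^ (2 : ℝ) ≤ Cs * G := by
      intro w hw
      rw [mem_closedBall, dist_zero_right] at hw
      calc ∫⁻ x, ‖T ψ w x‖ₑ ^ (2 : ℝ)
          ≤ ∫⁻ x, ‖∫ t, (1 - radialCutoff ε (2 * ε) t) * bogovskiiK2 ψ w i j k l t * g (x - t)‖ₑ ^ (2 : ℝ) := by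
            refine lintegral_mono fun x ↦ ?_
            simp only [hT]
            rw [enorm_mul]
            refine ENNReal.rpow_le_rpow ?_ (by norm_num)
            calc _ ≤ 1 * ‖∫ t, (1 - radialCutoff ε (2 * ε) t) * bogovskiiK2 ψ w i j k l t * g (x - t)‖ₑ := by
                  gcongr
                  rw [← ofReal_norm, Real.norm_eq_abs]
                  exact ENNReal.ofReal_le_one.2 (hζ1 x)
              _ = _ := one_mul _
        _ ≤ Cψ * G := hL ε hε w hw g hg hgc
        _ ≤ Cs * G := by gcongr
    calc ∫⁻ w in closedBall (0 : E3) (D + 1), ∫⁻ x, ‖T ψ w x‖ₑ ^ (2 : ℝ)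
        ≤ ∫⁻ _ in closedBall (0 : E3) (D + 1), Cs * G := setLIntegral_mono measurable_const hin
      _ = Vol * Cs * G := by rw [setLIntegral_const]; ring
  have e0 : C₀ ≤ Cs := by simp only [hCs]; exact le_self_add.trans (le_self_add.trans
    (le_self_add.trans (le_self_add.trans (le_self_add.trans (le_self_add.trans le_self_add)))))
  have et : Ct ≤ Cs := by
    simp only [hCs]
    calc Ct ≤ C₀ + Ct := le_add_self
      _ ≤ _ := le_self_add.trans (le_self_add.trans (le_self_add.trans (le_self_add.trans (le_self_add.trans le_self_add))))
  have ev : Cv ≤ Cs := by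
    simp only [hCs]
    calc Cv ≤ C₀ + Ct + Cv := le_add_self
      _ ≤ _ := le_self_add.trans (le_self_add.trans (le_self_add.trans (le_self_add.trans le_self_add)))
  have eu : Cu ≤ Cs := by
    simp only [hCs]
    calc Cu ≤ C₀ + Ct + Cv + Cu := le_add_self
      _ ≤ _ := le_self_add.trans (le_self_add.trans (le_self_add.trans le_self_add))
  have evt : Cvt ≤ Cs := by
    simp only [hCs]
    calc Cvt ≤ C₀ + Ct + Cv + Cu + Cvt := le_add_self
      _ ≤ _ := le_self_add.trans (le_self_add.trans le_self_add)
  have eut : Cut ≤ Cs := by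
    simp only [hCs]
    calc Cut ≤ C₀ + Ct + Cv + Cu + Cvt + Cut := le_add_self
      _ ≤ _ := le_self_add.trans le_self_add
  have euv : Cuv ≤ Cs := by
    simp only [hCs]
    calc Cuv ≤ C₀ + Ct + Cv + Cu + Cvt + Cut + Cuv := le_add_self
      _ ≤ _ := le_self_add
  have euvt : Cuvt ≤ Cs := by simp only [hCs]; exact le_add_self
  have T0 := hterm η C₀ e0 hL₀
  have Tt := hterm _ Ct et hLt
  have Tv := hterm _ Cv ev hLv
  have Tu := hterm _ Cu eu hLu
  have Tvt := hterm _ Cvt evt hLvt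
  have Tut := hterm _ Cut eut hLut
  have Tuv := hterm _ Cuv euv hLuv
  have Tuvt := hterm _ Cuvt euvt hLuvt
  calc ∫⁻ x, ‖T η x x‖ₑ ^ (2 : ℝ) ≤ _ := hmain
    _ ≤ Cd * ((((Vol * Cs * G) + (Vol * Cs * G)) + ((Vol * Cs * G) + (Vol * Cs * G))) +
        (((Vol * Cs * G) + (Vol * Cs * G)) + ((Vol * Cs * G) + (Vol * Cs * G)))) := by
        gcongr
    _ = Cd * (8 * (Vol * Cs)) * G := by ring

end MaoOhTao

end Literature.Geometry.Lorentzian
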